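import Mathlib
import HarnessLib
import Literature.Analysis.FluidPDE.TypeIAncientMild
import Literature.Analysis.FluidPDE.OseenSlice
import Literature.Analysis.FluidPDE.UlocKernelEstimates
import Literature.Analysis.FluidPDE.LerayVolterraComparison
import Literature.Analysis.FluidPDE.OseenDuhamelPairCalculus
import Summits.NavierStokesRegularity.NavierStokesRegularity.Theorems.QuarterLogPincerTruncationEdgeDefs
import Summits.NavierStokesRegularity.NavierStokesRegularity.Theorems.QuarterLogPincerTypeIQuantSubcubicExpFrameTools
import Summits.NavierStokesRegularity.NavierStokesRegularity.Theorems.QuarterLogPincerQuietCoreDefs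
import Summits.NavierStokesRegularity.NavierStokesRegularity.Theorems.QuarterLogPincerQuietCoreBudgetPassSlice
import Summits.NavierStokesRegularity.NavierStokesRegularity.Theorems.QuarterLogPincerQuietCoreBudgetPass
import Summits.NavierStokesRegularity.NavierStokesRegularity.Theorems.QuarterLogPincerQuietCoreRecedingTools
import Summits.NavierStokesRegularity.NavierStokesRegularity.Theorems.QuarterLogPincerQuietCoreRecessionLaw
import Summits.NavierStokesRegularity.NavierStokesRegularity.Theorems.QuarterLogPincerQuietCoreFarKick
import Summits.NavierStokesRegularity.NavierStokesRegularity.Theorems.QuarterLogPincerQuietCoreAssemblyTools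
import Summits.NavierStokesRegularity.NavierStokesRegularity.Theorems.QuarterLogPincerQuietCoreKeyStep

/-!
# Route `QuarterLogPincer`, crux `TypeIQuantSubcubicExp` (stmt-NavierStokesRegularity-24077), line `quiet_core` —
# §1e part 2 (PROVED in-file v1.5; ported VERBATIM): S3♭ `stub_subcriticalUpgrade : StubSubcriticalUpgrade` BY NAME and ★★ `quietCore_all : ∀ M B, QuietCore M B` — QC UNCONDITIONAL

`subcriticalUpgrade_all` (real induction `IsClosed.Icc_subset_of_forall_mem_nhdsWithin` on the receding-ball scheme, `keyStep`),
`stub_subcriticalUpgrade`, `quietCore_skeleton`, `quietCore_all`.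
HONEST FRAME: estimates about HYPOTHETICAL Type-I ancient mild fields; nothing here bears on 24077, W7 or Navier–Stokes
regularity (OPEN).  Port by the pub-ns-dss typer (g36), DIRECTOR-NS KEY-NS #181/#182; bodies VERBATIM from tree `Lines/quiet_core.lean`
v1.5 (sha12 d1a96bf31391, ns-idea-7 g10; critic of record idea-crit-4 g6); docstrings added where the line had none.
-/

noncomputable section

set_option linter.dupNamespace false

namespace Summit.NavierStokesRegularity.NavierStokesRegularity.Cruxes.TypeIQuantSubcubicExp.QuietCore

open MeasureTheory Set Function Metric Filter Topology
open scoped ENNReal NNReal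
open Literature.Analysis Literature.Analysis.FluidPDE
open Summit.NavierStokesRegularity.NavierStokesRegularity.Cruxes.TypeIQuantSubcubicExp.TruncationEdge

section Assembly
open Real

set_option maxHeartbeats 2000000 in
/-- **T4 · S3♭ PROVED: the subcritical upgrade `SubcriticalUpgrade M` for every `M`** (receding-ball real induction).
Constants (chosen before the field): `C` the Oseen-kernel constant, `I₁ = I + 1` (kernel mass), `M₁ = |M| + 1`,
`c₀ = 1/(128 C I₁ + 1)`, `κ = 192π C M₁²/c₀`, `c₁ = 2 + 2|log κ| + |log(I₁²/(16π²))|`,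
`b₁ = min (1/(64κ(c₁+8)))² (c₀/(2048 M₁))`, `s₁ = −b₁`.  Induction set `S = {t' | ∀ t'' ∈ (s,t'), G t''}` (closed for free),
right-openness by `keyStep`, `IsClosed.Icc_subset_of_forall_mem_nhdsWithin`; no continuity of `v` in time is used. -/

theorem subcriticalUpgrade_all (M : ℝ) : SubcriticalUpgrade M := by
  obtain ⟨C, hC, hK⟩ := exists_norm_oseenKernel_le (E := EuclideanSpace ℝ (Fin 3))
  set I : ℝ := ∫ w : EuclideanSpace ℝ (Fin 3), (1 + ‖w‖ ^ 2) ^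
      (-(((Module.finrank ℝ (EuclideanSpace ℝ (Fin 3)) : ℝ) + 1) / 2)) with hI_def
  have hI0 : 0 ≤ I := integral_nonneg fun w => Real.rpow_nonneg (by positivity) _
  set I₁ : ℝ := I + 1 with hI₁
  have hI₁pos : 0 < I₁ := by rw [hI₁]; linarith
  have hII₁ : I ≤ I₁ := by rw [hI₁]; linarith
  set M₁ : ℝ := |M| + 1 with hM₁_def
  have hM₁ : 0 < M₁ := by rw [hM₁_def]; positivity
  have hMM₁ : M ≤ M₁ := by rw [hM₁_def]; linarith [le_abs_self M]
  set c₀ : ℝ := 1 / (128 * C * I₁ + 1) with hc₀_def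
  have hden : 0 < 128 * C * I₁ + 1 := by positivity
  have hc₀ : 0 < c₀ := by rw [hc₀_def]; positivity
  have hc₀I : 128 * C * I₁ * c₀ ≤ 1 := by
    rw [hc₀_def, ← mul_div_assoc, mul_one, div_le_one hden]; linarith
  set κ : ℝ := 192 * π * C * M₁ ^ 2 / c₀ with hκ_def
  have hκ : 0 < κ := by rw [hκ_def]; positivity
  have hκc : C * M₁ ^ 2 * (96 * π / κ) ≤ c₀ / 2 := by
    have : C * M₁ ^ 2 * (96 * π / κ) = c₀ / 2 := by
      rw [hκ_def]; field_simp; ring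
    rw [this]
  set c₁ : ℝ := 2 + 2 * |Real.log κ| + |Real.log (I₁ ^ 2 / (16 * π ^ 2))| with hc₁_def
  have hc₁ : 2 + 2 * |Real.log κ| + |Real.log (I₁ ^ 2 / (16 * π ^ 2))| ≤ c₁ := by rw [hc₁_def]
  have hc₁pos : 0 < c₁ := by rw [hc₁_def]; positivity
  set b₁ : ℝ := min ((1 / (64 * κ * (c₁ + 8))) ^ 2) (c₀ / (2048 * M₁)) with hb₁_def
  have hb₁ : 0 < b₁ := by rw [hb₁_def]; positivity
  refine ⟨c₀, -b₁, hc₀, by linarith, ?_⟩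
  intro v hv s hs hq t ht x hx
  have hs0 : s < 0 := hs.2
  have hb : 0 < -s := by linarith
  have hsb : -s ≤ b₁ := by linarith [hs.1]
  -- smallness 1: `Φ(b) = 8κ(c₁+8)√b ≤ 1/8`
  have hΦb : recessPhi κ (-s) c₁ (-s) ≤ 1 / 8 := by
    rw [recessPhi_self hb]
    have h64 : 0 < 64 * κ * (c₁ + 8) := by positivity
    have hsq : Real.sqrt (-s) ≤ 1 / (64 * κ * (c₁ + 8)) := by
      rw [← Real.sqrt_sq (le_of_lt (by positivity : (0 : ℝ) < 1 / (64 * κ * (c₁ + 8))))]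
      exact Real.sqrt_le_sqrt (hsb.trans (min_le_left _ _))
    calc 8 * κ * (c₁ + 8) * Real.sqrt (-s) ≤ 8 * κ * (c₁ + 8) * (1 / (64 * κ * (c₁ + 8))) := by gcongr
      _ = 1 / 8 := by field_simp; ring
  -- smallness 2: the Gaussian tail of the heat part, `2^{3/2}·512·M₁·b ≤ c₀`
  have hheat : (2 : ℝ) ^ (3 / 2 : ℝ) * 512 * M₁ * (-s) ≤ c₀ := by
    have h232 : (2 : ℝ) ^ (3 / 2 : ℝ) ≤ 4 := by
      have h := Real.rpow_le_rpow_of_exponent_le (by norm_num : (1 : ℝ) ≤ 2) (by norm_num : (3 / 2 : ℝ) ≤ 2)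
      have h4 : (2 : ℝ) ^ (2 : ℝ) = 4 := by norm_num
      rwa [h4] at h
    have hb2 : -s ≤ c₀ / (2048 * M₁) := hsb.trans (min_le_right _ _)
    calc (2 : ℝ) ^ (3 / 2 : ℝ) * 512 * M₁ * (-s) ≤ 4 * 512 * M₁ * (c₀ / (2048 * M₁)) := by gcongr
      _ = c₀ := by field_simp; ring
  -- the receding-ball property `G`
  have key : ∀ t₁ : ℝ, s ≤ t₁ → t₁ < 0 →
      (∀ t' ∈ Set.Ioo s t₁, ∀ y : EuclideanSpace ℝ (Fin 3), ‖y‖ < 3 / 4 + recessPhi κ (-s) c₁ (-t') →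
        ‖v t' y‖ ≤ 4 * c₀ * (-s) ^ (-(3 / 8 : ℝ)) * (-t') ^ (-(1 / 8 : ℝ))) →
      ∃ η : ℝ, 0 < η ∧ ∀ t'' : ℝ, s < t'' → t₁ ≤ t'' → t'' < t₁ + η → t'' < 0 →
        ∀ y : EuclideanSpace ℝ (Fin 3), ‖y‖ < 3 / 4 + recessPhi κ (-s) c₁ (-t'') →
          ‖v t'' y‖ ≤ 4 * c₀ * (-s) ^ (-(3 / 8 : ℝ)) * (-t'') ^ (-(1 / 8 : ℝ)) :=
    fun t₁ hst₁ ht₁ hyp => keyStep hC hK hII₁ hI₁pos hM₁ hMM₁ hc₀ hc₀I hκ hκc hc₁ hs0 hΦb hheat hv hq hst₁ ht₁ hyp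
  set G : ℝ → Prop := fun t' => ∀ y : EuclideanSpace ℝ (Fin 3), ‖y‖ < 3 / 4 + recessPhi κ (-s) c₁ (-t') →
    ‖v t' y‖ ≤ 4 * c₀ * (-s) ^ (-(3 / 8 : ℝ)) * (-t') ^ (-(1 / 8 : ℝ)) with hG_def
  -- base: `G s` from quietness (`‖y‖ < 3/4 + Φ(b) ≤ 7/8 < 1`, `c₀/√b ≤ 4c₀ b^{-3/8} b^{-1/8}`)
  have hGs : G s := by
    intro y hy
    have hy1 : ‖y‖ < 1 := by linarith
    refine (hq y (mem_ball_zero_iff.2 hy1)).trans ?_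
    have e : (-s) ^ (-(3 / 8 : ℝ)) * (-s) ^ (-(1 / 8 : ℝ)) = 1 / Real.sqrt (-s) := by
      rw [← Real.rpow_add hb, show (-(3 / 8 : ℝ)) + -(1 / 8 : ℝ) = -(1 / 2 : ℝ) by norm_num,
        Real.rpow_neg hb.le, Real.sqrt_eq_rpow, inv_eq_one_div]
    have hsq0 : 0 ≤ 1 / Real.sqrt (-s) := by positivity
    calc c₀ / Real.sqrt (-s) = c₀ * (1 / Real.sqrt (-s)) := by ring
      _ ≤ 4 * c₀ * (1 / Real.sqrt (-s)) := by nlinarith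
      _ = 4 * c₀ * (-s) ^ (-(3 / 8 : ℝ)) * (-s) ^ (-(1 / 8 : ℝ)) := by rw [mul_assoc (4 * c₀), e]
  have hx34 : ‖x‖ < 3 / 4 := mem_ball_zero_iff.1 hx
  have hΦt : 0 ≤ recessPhi κ (-s) c₁ (-t) :=
    recessPhi_nonneg hκ.le hb hc₁pos.le (by linarith [ht.2]) (by linarith [ht.1])
  rcases eq_or_lt_of_le ht.1 with heq | hlt
  · -- `t = s`
    have hGt : G t := by rw [← heq]; exact hGs
    exact hGt x (by linarith)
  · -- `s < t`: real induction on `[s, t]`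
    set S : Set ℝ := {t' | ∀ t'' ∈ Set.Ioo s t', G t''} with hS_def
    have hS_closed : IsClosed S := by
      have hS : S = ⋂ t'' : ℝ, {t' : ℝ | t'' < t' → (s < t'' → G t'')} := by
        ext t'
        simp only [hS_def, Set.mem_setOf_eq, Set.mem_iInter, Set.mem_Ioo]
        exact ⟨fun h t'' h1 h2 => h t'' ⟨h2, h1⟩, fun h t'' ht'' => h t'' ht''.2 ht''.1⟩
      rw [hS]
      refine isClosed_iInter fun t'' => ?_
      by_cases hP : (s < t'' → G t'')
      · have h1 : {t' : ℝ | t'' < t' → (s < t'' → G t'')} = Set.univ := Set.eq_univ_of_forall fun t' _ => hP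
        rw [h1]; exact isClosed_univ
      · have h1 : {t' : ℝ | t'' < t' → (s < t'' → G t'')} = Set.Iic t'' := by
          ext t'
          simp only [Set.mem_setOf_eq, Set.mem_Iic]
          exact ⟨fun h => not_lt.1 fun hlt' => hP (h hlt'), fun h hlt' => absurd hlt' (not_lt.2 h)⟩
        rw [h1]; exact isClosed_Iic
    have hsS : s ∈ S := fun t'' ht'' => absurd ht''.2 (not_lt.2 ht''.1.le)
    have hstepS : ∀ t' ∈ S ∩ Set.Ico s t, S ∈ 𝓝[>] t' := by
      rintro t' ⟨ht'S, ht'⟩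
      have ht'0 : t' < 0 := ht'.2.trans ht.2
      obtain ⟨η, hη, hstep⟩ := key t' ht'.1 ht'0 ht'S
      refine mem_nhdsGT_iff_exists_Ioo_subset.2 ⟨t' + min η (-t' / 2), ?_, fun t₃ ht₃ => ?_⟩
      · show t' < t' + min η (-t' / 2)
        have : 0 < min η (-t' / 2) := lt_min hη (by linarith)
        linarith
      · intro t'' ht''
        rcases lt_or_ge t'' t' with h | h
        · exact ht'S t'' ⟨ht''.1, h⟩
        · have h3 : t₃ < t' + min η (-t' / 2) := ht₃.2
          exact hstep t'' ht''.1 h (by linarith [min_le_left η (-t' / 2), ht''.2])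
            (by linarith [min_le_right η (-t' / 2), ht''.2])
    have hind : Set.Icc s t ⊆ S :=
      IsClosed.Icc_subset_of_forall_mem_nhdsWithin (hS_closed.inter isClosed_Icc) hsS hstepS
    have htS : t ∈ S := hind (Set.right_mem_Icc.2 ht.1)
    obtain ⟨η, hη, hstep⟩ := key t ht.1 ht.2 htS
    have hGt : G t := hstep t hlt le_rfl (by linarith) ht.2
    exact hGt x (by linarith)


end Assembly


/-- **Stub S3♭ — PROVED (v1.5)** by the receding-ball real induction `subcriticalUpgrade_all` (§1e; toolbox §1c–§1d).
The registered name and statement are unchanged. -/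
theorem stub_subcriticalUpgrade : StubSubcriticalUpgrade := subcriticalUpgrade_all

/-- QC as it stands in this skeleton: **a theorem** (both registered stubs it rests on, S3♭ and S4♭, are proved in-file;
no `sorry` in its cone). -/
theorem quietCore_skeleton : StubQuietCore := stubQuietCore_of stub_subcriticalUpgrade stub_budgetPass

/-- `QuietCore M B` for all `M, B` — unconditional (v1.5). -/
theorem quietCore_all (M B : ℝ) : QuietCore M B := quietCore_skeleton M B



end Summit.NavierStokesRegularity.NavierStokesRegularity.Cruxes.TypeIQuantSubcubicExp.QuietCore

end
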